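import Mathlib
import Summits.AtomisticToContinuum.FouriersLaw.Theses.MatthiessenLadder

/-!
# `IncrementGlue` — telescoping the Matthiessen increments (route MatthiessenLadder)

Item stmt-AtomisticToContinuum-12780 (support):
`PrefixIncrementBounds → PrefixSteadyStates → BoundedResponse`.

Fix parameters `ω₂, lam, β, γ > 0`, a steady-state family `μ` of `pinnedChain ω₂ lam β γ`, `T > 0`
and response limits `D N`. Since `cellChain ω₂ lam β γ (fun _ => true)` IS the pinned chain
(`cellChain_const_true`, `rfl`) and response coefficients are local in the cells below `N`
(`cellChain_isResponseCoeff_congr`), `D N` is a response coefficient of the top rung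
`cellChain (· < N)` at size `N`. `PrefixSteadyStates` supplies response coefficients `E k N` of every
rung `cellChain (· < k)`; `PrefixIncrementBounds` bounds each increment of the resistances
`R k = (N - 1) / F k` (`F k = E k N` for `k < N`, `F N = D N`) below by `-rmax` always and by `rmin` in
the bulk `k₀ ≤ k < N - k₀`. Telescoping (`Finset.sum_range_sub`) with at most `2 k₀` non-bulk indices
gives `(N - 1) / D N ≥ N rmin - 2 k₀ (rmin + rmax)` with `D N > 0`, hence `D N ≤ 2 / rmin` for
`N ≥ N₁`; the finitely many `N < N₁` are absorbed into the bound.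
-/

namespace Summit.AtomisticToContinuum.FouriersLaw.Theorems

open Literature.MathematicalPhysics.KineticTheory.HeatConduction
open Filter Topology

/-- Telescoping with two-sided increments: if every increment `R (k+1) - R k`, `k < N`, is at least
`-rmax`, and at least `rmin` for the bulk indices `k₀ ≤ k`, `k + k₀ < N` (of which at most `2 k₀`
fail), then `R N - R 0 ≥ N rmin - 2 k₀ (rmin + rmax)`. -/
theorem incrementGlue_telescope {N k₀ : ℕ} {rmin rmax : ℝ} (R : ℕ → ℝ)
    (hup : ∀ k, k < N → -rmax ≤ R (k + 1) - R k)
    (hlow : ∀ k, k < N → k₀ ≤ k → k + k₀ < N → rmin ≤ R (k + 1) - R k)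
    (hrmin : 0 ≤ rmin) (hrmax : 0 ≤ rmax) :
    (N : ℝ) * rmin - 2 * k₀ * (rmin + rmax) ≤ R N - R 0 := by
  classical
  rw [← Finset.sum_range_sub]
  have hterm : ∀ k ∈ Finset.range N,
      (if k₀ ≤ k ∧ k + k₀ < N then rmin else -rmax) ≤ R (k + 1) - R k := by
    intro k hk
    rw [Finset.mem_range] at hk
    split_ifs with h
    · exact hlow k hk h.1 h.2
    · exact hup k hk
  refine le_trans ?_ (Finset.sum_le_sum hterm)
  rw [Finset.sum_ite, Finset.sum_const, Finset.sum_const, nsmul_eq_mul, nsmul_eq_mul]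
  have hcard := Finset.card_filter_add_card_filter_not (s := Finset.range N)
    (fun k => k₀ ≤ k ∧ k + k₀ < N)
  rw [Finset.card_range] at hcard
  have hnb : ((Finset.range N).filter fun k => ¬(k₀ ≤ k ∧ k + k₀ < N)).card ≤ 2 * k₀ := by
    calc ((Finset.range N).filter fun k => ¬(k₀ ≤ k ∧ k + k₀ < N)).card
        ≤ (Finset.range k₀ ∪ Finset.Ico (N - k₀) N).card := by
          apply Finset.card_le_card
          intro k hk
          simp only [Finset.mem_filter, Finset.mem_range, not_and, not_lt] at hk
          simp only [Finset.mem_union, Finset.mem_range, Finset.mem_Ico]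
          omega
      _ ≤ (Finset.range k₀).card + (Finset.Ico (N - k₀) N).card := Finset.card_union_le _ _
      _ ≤ 2 * k₀ := by rw [Finset.card_range, Nat.card_Ico]; omega
  have ha : (((Finset.range N).filter fun k => k₀ ≤ k ∧ k + k₀ < N).card : ℝ)
      = N - ((Finset.range N).filter fun k => ¬(k₀ ≤ k ∧ k + k₀ < N)).card := by
    have h' : (((Finset.range N).filter fun k => k₀ ≤ k ∧ k + k₀ < N).card : ℝ)
        + ((Finset.range N).filter fun k => ¬(k₀ ≤ k ∧ k + k₀ < N)).card = N := by
      exact_mod_cast hcard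
    linarith
  have hb : (((Finset.range N).filter fun k => ¬(k₀ ≤ k ∧ k + k₀ < N)).card : ℝ) ≤ 2 * k₀ := by
    exact_mod_cast hnb
  rw [ha]
  nlinarith [mul_le_mul_of_nonneg_right hb (add_nonneg hrmin hrmax)]

/-- The response limits of a steady-state family of the pinned chain are response coefficients of
the top rung `cellChain ω₂ lam β γ (· < N)` of the prefix ladder (all cells below `N` switched on IS
the pinned chain at size `N`: `cellChain_const_true` + locality `cellChain_isResponseCoeff_congr`). -/
theorem incrementGlue_isResponseCoeff_top {ω₂ lam β γ T : ℝ} {N : ℕ} {D : ℝ}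
    (μ : ℝ → ℝ → MeasureTheory.Measure (PhaseSpace N))
    (hμ : ∀ T_L T_R : ℝ, 0 < T_L → 0 < T_R → (pinnedChain ω₂ lam β γ).IsSteadyState N T_L T_R (μ T_L T_R))
    (hD : Tendsto (fun δ : ℝ => (pinnedChain ω₂ lam β γ).totalCurrent (μ (T + δ / 2) (T - δ / 2)) / δ)
      (𝓝[≠] 0) (𝓝 D)) :
    (cellChain ω₂ lam β γ (fun i => decide (i < N))).IsResponseCoeff N T D := by
  rw [cellChain_isResponseCoeff_congr ω₂ lam β γ (c' := fun _ => true) (fun i hi => by simp [hi]),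
    cellChain_const_true]
  exact ⟨μ, hμ, hD⟩

/-- `IncrementGlue` (item stmt-AtomisticToContinuum-12780): the Matthiessen increments of the prefix
ladder (`PrefixIncrementBounds`) together with the response coefficients of its rungs
(`PrefixSteadyStates`) telescope to bounded response along every steady-state family of the pinned
chain (`BoundedResponse`); the uniqueness hypothesis of `BoundedResponse` is not used. -/
theorem incrementGlue_proof :
    Summit.AtomisticToContinuum.FouriersLaw.Theses.MatthiessenLadder.IncrementGlue := by
  unfold Summit.AtomisticToContinuum.FouriersLaw.Theses.MatthiessenLadder.IncrementGlue
    Summit.AtomisticToContinuum.FouriersLaw.Theses.MatthiessenLadder.BoundedResponse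
  intro hPIB hPSS ω₂ lam β γ hω hl hβ hγ _ μ hμ T hT D hD
  obtain ⟨rmin, rmax, hrmin, hle, k₀, N₀, hinc⟩ := hPIB ω₂ lam β γ hω hl hβ hγ T hT
  have hrmax : 0 ≤ rmax := hrmin.le.trans hle
  -- response coefficients of the rungs `cellChain (· < k)` at size `N` (PrefixSteadyStates)
  have hE : ∀ k N : ℕ, ∃ E : ℝ,
      (cellChain ω₂ lam β γ (fun i => decide (i < k))).IsResponseCoeff N T E :=
    fun k N => (hPSS ω₂ lam β γ hω hl hβ hγ k).2 N T hT
  choose E hE using hE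
  -- the given limits are response coefficients of the top rung
  have hDN : ∀ N : ℕ, (cellChain ω₂ lam β γ (fun i => decide (i < N))).IsResponseCoeff N T (D N) :=
    fun N => incrementGlue_isResponseCoeff_top (μ N) (hμ N) (hD N)
  -- the telescoped lower bound on the resistance of the top rung, and positivity
  have hmain : ∀ N : ℕ, N₀ ≤ N → 1 ≤ N →
      0 < D N ∧ (N : ℝ) * rmin - 2 * k₀ * (rmin + rmax) ≤ ((N : ℝ) - 1) / D N := by
    intro N hN₀ hN1
    -- the ladder of coefficients: rungs `k < N` from PrefixSteadyStates, the top rung is `D N`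
    let F : ℕ → ℝ := fun k => if k < N then E k N else D N
    have hF : ∀ k, k ≤ N →
        (cellChain ω₂ lam β γ (fun i => decide (i < k))).IsResponseCoeff N T (F k) := by
      intro k hk
      rcases Nat.lt_or_ge k N with h | h
      · simp only [F, if_pos h]
        exact hE k N
      · have hkN : k = N := le_antisymm hk h
        rw [hkN]
        simp only [F, if_neg (lt_irrefl N)]
        exact hDN N
    have hstep : ∀ k, k < N → 0 < F k ∧ 0 < F (k + 1) ∧
        |((N : ℝ) - 1) / F (k + 1) - ((N : ℝ) - 1) / F k| ≤ rmax ∧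
        (k₀ ≤ k → k + k₀ < N → rmin ≤ ((N : ℝ) - 1) / F (k + 1) - ((N : ℝ) - 1) / F k) :=
      fun k hk => hinc N k hN₀ hk (F k) (F (k + 1)) (hF k hk.le) (hF (k + 1) hk)
    have htel := incrementGlue_telescope (N := N) (k₀ := k₀) (fun k => ((N : ℝ) - 1) / F k)
      (fun k hk => (abs_le.mp (hstep k hk).2.2.1).1)
      (fun k hk h₁ h₂ => (hstep k hk).2.2.2 h₁ h₂) hrmin.le hrmax
    have hFN : F N = D N := by simp [F]
    have hF0 : 0 < F 0 := (hstep 0 hN1).1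
    have hN1' : (1 : ℝ) ≤ N := by exact_mod_cast hN1
    have hR0 : 0 ≤ ((N : ℝ) - 1) / F 0 := div_nonneg (by linarith) hF0.le
    have hDpos : 0 < D N := by
      have := (hstep (N - 1) (Nat.sub_lt hN1 Nat.one_pos)).2.1
      rwa [Nat.sub_add_cancel hN1, hFN] at this
    refine ⟨hDpos, ?_⟩
    rw [hFN] at htel
    linarith
  -- beyond `N₁` the coefficients are at most `2 / rmin`
  obtain ⟨N₁, hN₁⟩ : ∃ N₁ : ℕ, ∀ N : ℕ, N₁ ≤ N → |D N| ≤ 2 / rmin := by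
    refine ⟨max (max N₀ 2) ⌈2 * (2 * k₀ * (rmin + rmax)) / rmin⌉₊, fun N hN => ?_⟩
    have hN₀ : N₀ ≤ N := le_trans (le_trans (le_max_left _ _) (le_max_left _ _)) hN
    have hN2 : 2 ≤ N := le_trans (le_trans (le_max_right _ _) (le_max_left _ _)) hN
    have hNc : 2 * (2 * k₀ * (rmin + rmax)) / rmin ≤ N :=
      le_trans (Nat.le_ceil _) (by exact_mod_cast le_trans (le_max_right _ _) hN)
    obtain ⟨hDpos, hlow⟩ := hmain N hN₀ (le_trans (by norm_num) hN2)
    have hN2' : (2 : ℝ) ≤ N := by exact_mod_cast hN2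
    rw [abs_of_pos hDpos]
    -- `N rmin - C ≥ (N - 1) rmin / 2` since `N rmin ≥ 2 C`
    have hC : 2 * (2 * k₀ * (rmin + rmax)) ≤ N * rmin := by
      rwa [div_le_iff₀ hrmin] at hNc
    have hkey : ((N : ℝ) - 1) * (rmin / 2) ≤ ((N : ℝ) - 1) / D N := by nlinarith
    rw [div_eq_mul_inv, div_eq_mul_inv] at hkey
    have hN1' : (0 : ℝ) < N - 1 := by linarith
    have hinv : rmin / 2 ≤ (D N)⁻¹ := by
      have := le_of_mul_le_mul_left hkey hN1'
      simpa [div_eq_mul_inv] using this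
    calc D N = ((D N)⁻¹)⁻¹ := (inv_inv _).symm
      _ ≤ (rmin / 2)⁻¹ := inv_anti₀ (by positivity) hinv
      _ = 2 / rmin := by rw [inv_div]
  -- absorb the finitely many `N < N₁`
  refine ⟨(∑ n ∈ Finset.range N₁, |D n|) + 2 / rmin, ?_⟩
  rintro _ ⟨N, rfl⟩
  have hsum : 0 ≤ ∑ n ∈ Finset.range N₁, |D n| := Finset.sum_nonneg fun n _ => abs_nonneg _
  have h2 : 0 ≤ 2 / rmin := div_nonneg (by norm_num) hrmin.le
  rcases Nat.lt_or_ge N N₁ with h | h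
  · have : |D N| ≤ ∑ n ∈ Finset.range N₁, |D n| :=
      Finset.single_le_sum (f := fun n => |D n|) (fun n _ => abs_nonneg _) (Finset.mem_range.mpr h)
    simp only at this ⊢
    linarith
  · have := hN₁ N h
    simp only
    linarith

end Summit.AtomisticToContinuum.FouriersLaw.Theorems
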